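import Literature.AnabelianGeometry.SemiGraphs.TemperedMaximalCompactZornTrees
import Literature.AnabelianGeometry.SemiGraphs.TemperedMaximalCompactZornLimit
import Literature.AnabelianGeometry.SemiGraphs.TemperedPiFibreFaithful
import Literature.AnabelianGeometry.SemiGraphs.TemperedPiDecompositionEdgesStab
import Literature.AnabelianGeometry.SemiGraphs.TemperedPiChartExists
import Literature.AnabelianGeometry.SemiGraphs.UniformSplittingStrictlyCoherentProofs
import HarnessLib

/-!
# Finite subgroups of the level groups `Gal(𝒢_{∞,n}/𝒢)` have bounded order; maximal compact
# subgroups of `π₁^temp(𝒢)` exist above every compact subgroup ([SemiAnbd] Thm 3.7 (iv) p. 41)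

Mochizuki, *Semi-graphs of anabelioids*, Publ. RIMS **42** (2006), §3: Prop. 3.6 p. 38 (the tower
`π₁^temp(𝒢) = lim_n Gal(𝒢_{∞,n}/𝒢)`), Thm. 3.7 (iv) p. 41 ("the maximal compact subgroups of `π₁^temp(𝒢)`
are precisely the verticial subgroups") [cite: MochizukiSemiAnbd2006, Thm 3.7(iv) p.41], Lemma 1.8 (ii)(a)
p. 20 (a finite group acting on a tree fixes a vertex or an edge) [cite: MochizukiSemiAnbd2006, Lem. 1.8(ii)(a) p.20].

PROOF-ONLY file (no definitions).  It DISCHARGES, for every Galois level data `D` over a connected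
countable `𝒢` with finite levels — in particular for the canonical tower of Prop. 3.6
(`galoisLevelData h36`) — the binder

  `hbd : ∀ n, ∃ B, ∀ H : Subgroup (Gal(𝒢_{∞,n}/𝒢)), H finite → Nat.card H ≤ B`

of abc-iut-w6-d120's Zorn lemma `GaloisLevelData.exists_isMaximalCompactSubgroup_ge` (p438140,
`TemperedMaximalCompactZornLimit.lean`): a finite `H ≤ Gal(𝒢_{∞,n}/𝒢) = Aut(𝒢_{∞,n})` acts on the tree
`𝔾̃_n` (`galTreeAct`), hence fixes a vertex or an edge of it (Lem. 1.8 (ii)(a), through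
`SemiGraph.ncard_le_of_finite_of_treeAction`, p436156), and the `Aut(𝒢_{∞,n})`-stabiliser of a tree
vertex `[t]` (an orbit of points of `𝒢_{∞,n}` over `v`) INJECTS into the finite fibre `(𝒢_n)_v` by
`σ ↦ (image in 𝒢_n of σ·t)`: `[σ t] = [t]` makes `σ t = k · t` for some `k ∈ Π_v`
(`CovObj.exists_ρ_of_mk_eq_mk`), two such `k` with the same image point differ by an element of the
stabiliser of the image point, which fixes `t` itself (`Π_v` acts on `𝒢_{∞,n}` through `𝒢_n`,
abc-iut-L3-t6 `cover_ρ_eq_self_of_proj`, p419083), and `σ` is determined by `σ t` (rigidity,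
`CovObj.univCoverOver_hom_ext`); likewise for edges.  On a connected `𝒢` all fibres of `𝒢_n` have one
cardinality (`CovObj.nodeCard_eq_of_reachable`), which is the bound `B`.

Consequence (binder-free): **every compact subgroup of `π₁^temp(𝒢)` lies in a maximal compact
subgroup** (`exists_isMaximalCompactSubgroup_ge_of_isFinite`, and at the canonical chart
`ProfiniteSemiGraph.exists_isMaximalCompactSubgroup_ge_temperedPiChart`) — the input of the kernel
refutation of the ∀-countable reading of Thm. 3.7 (iv) (`MaximalCompactIffVerticial`, FACT-LIST F-1750)
at abc-iut-L3-d1's countermodel `𝒢_θ` in the FRONTIER programme SUBDAG-REFUTE-F1732 (print proves the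
finite-semi-graph statement; IUT uses finite dual semi-graphs).  Seat abc-iut-L3-t6 (lineage DECOMP).
Nothing here is asserted about any particular graph; nothing here bears on [IUTchIII] Cor. 3.12.
-/

namespace Literature.AnabelianGeometry.SemiGraphs

namespace ProfiniteSemiGraph

open CategoryTheory Topology
open Literature.AlgebraicGeometry.Frobenioids.QuasiTemperoid.BTempConnected (ρ_one_apply
  ρ_mul_apply)

universe u

namespace GaloisLevelData

variable {𝒢 : ProfiniteSemiGraph.{u}} (D : GaloisLevelData 𝒢) (h𝒢 : 𝒢.IsCountable)

/-! ### `Π_e` acts on `𝒢_{∞,n}` through `𝒢_n` (edge twin of `cover_ρ_eq_self_of_proj`) -/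

/-- Edge twin of abc-iut-L3-t6's `cover_ρ_eq_self_of_proj`: if `h ∈ Π_e` fixes the image point of
`𝒢_n`, it fixes the point of `𝒢_{∞,n}` over `e` (orbit and path class are untouched).
[cite: MochizukiSemiAnbd2006, Prop 3.6 p.38] -/
theorem cover_ρE_eq_self_of_proj (n : ℕ) {e : 𝒢.graph.Edge} (h : 𝒢.Ge e)
    (t : ((D.cover h𝒢 n).SE e).obj.V)
    (ht : ((D.S n).SE e).obj.ρ h ((((D.S n).univCoverOverProj (Sum.inl (D.W n)) h𝒢).fE e).hom.hom t) =
      (((D.S n).univCoverOverProj (Sum.inl (D.W n)) h𝒢).fE e).hom.hom t) :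
    ((D.cover h𝒢 n).SE e).obj.ρ h t = t :=
  CovObj.FibE.ext (D.S n) (Sum.inl (D.W n)) rfl ht HEq.rfl

/-! ### Stabilisers of tree vertices and tree edges in `Aut(𝒢_{∞,n})` inject into the fibres of `𝒢_n` -/

/-- An element of `Π_v` moving `t` to `σ t`, read from `[σ t] = [t]`.
[cite: MochizukiSemiAnbd2006, Thm 3.7(iii) p.41] -/
theorem exists_ρ_eq_apply_of_fixes_vertexMk (n : ℕ) {v : 𝒢.graph.Vertex}
    (t : ((D.cover h𝒢 n).SV v).obj.V) (σ : D.Gal h𝒢 n)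
    (hσ : (D.galTreeAct h𝒢 n σ).hom.vertexMap ((D.treeIso h𝒢 n).hom.vertexMap (Quot.mk _ ⟨v, t⟩)) =
      (D.treeIso h𝒢 n).hom.vertexMap (Quot.mk _ ⟨v, t⟩)) :
    ∃ k : 𝒢.Gv v, ((D.cover h𝒢 n).SV v).obj.ρ k t = (σ.hom.fV v).hom.hom t := by
  rw [D.galTreeAct_vertexMap_mk h𝒢 n σ t] at hσ
  obtain ⟨k, hk⟩ := CovObj.exists_ρ_of_mk_eq_mk (D.cover h𝒢 n) (D.mk_eq_mk_of_vertexMap_eq h𝒢 n _ _ hσ)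
  refine ⟨k⁻¹, ?_⟩
  have h1 := congrArg (((D.cover h𝒢 n).SV v).obj.ρ k⁻¹) hk
  rw [← ρ_mul_apply, inv_mul_cancel, ρ_one_apply] at h1
  exact h1.symm

/-- Edge twin of `exists_ρ_eq_apply_of_fixes_vertexMk`. [cite: MochizukiSemiAnbd2006, Thm 3.7(iii) p.41] -/
theorem exists_ρ_eq_apply_of_fixes_edgeMk (n : ℕ) {e : 𝒢.graph.Edge}
    (t : ((D.cover h𝒢 n).SE e).obj.V) (σ : D.Gal h𝒢 n)
    (hσ : (D.galTreeAct h𝒢 n σ).hom.edgeMap ((D.treeIso h𝒢 n).hom.edgeMap (Quot.mk _ ⟨e, t⟩)) =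
      (D.treeIso h𝒢 n).hom.edgeMap (Quot.mk _ ⟨e, t⟩)) :
    ∃ k : 𝒢.Ge e, ((D.cover h𝒢 n).SE e).obj.ρ k t = (σ.hom.fE e).hom.hom t := by
  rw [D.galTreeAct_edgeMap_mk h𝒢 n σ t] at hσ
  obtain ⟨k, hk⟩ := CovObj.exists_ρE_of_mk_eq_mk (D.cover h𝒢 n) (D.mkE_eq_mkE_of_edgeMap_eq h𝒢 n _ _ hσ)
  refine ⟨k⁻¹, ?_⟩
  have h1 := congrArg (((D.cover h𝒢 n).SE e).obj.ρ k⁻¹) hk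
  rw [← ρ_mul_apply, inv_mul_cancel, ρ_one_apply] at h1
  exact h1.symm

/-- **The `Aut(𝒢_{∞,n})`-stabiliser of the tree vertex `[t]` injects into the fibre `(𝒢_n)_v`** by
`σ ↦ (image of σ t in 𝒢_n)`. [cite: MochizukiSemiAnbd2006, Thm 3.7(iv) p.41] -/
theorem injOn_proj_apply_of_fixes_vertexMk (n : ℕ) {v : 𝒢.graph.Vertex}
    (t : ((D.cover h𝒢 n).SV v).obj.V) :
    Set.InjOn (fun σ : D.Gal h𝒢 n =>
        (((D.S n).univCoverOverProj (Sum.inl (D.W n)) h𝒢).fV v).hom.hom ((σ.hom.fV v).hom.hom t))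
      {σ | (D.galTreeAct h𝒢 n σ).hom.vertexMap ((D.treeIso h𝒢 n).hom.vertexMap (Quot.mk _ ⟨v, t⟩)) =
        (D.treeIso h𝒢 n).hom.vertexMap (Quot.mk _ ⟨v, t⟩)} := by
  intro σ hσ σ' hσ' hf
  obtain ⟨k, hk⟩ := D.exists_ρ_eq_apply_of_fixes_vertexMk h𝒢 n t σ hσ
  obtain ⟨k', hk'⟩ := D.exists_ρ_eq_apply_of_fixes_vertexMk h𝒢 n t σ' hσ'
  simp only at hf
  rw [← hk, ← hk'] at hf
  have e1 := CovHom.fV_ρ ((D.S n).univCoverOverProj (Sum.inl (D.W n)) h𝒢) v k t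
  have e2 := CovHom.fV_ρ ((D.S n).univCoverOverProj (Sum.inl (D.W n)) h𝒢) v k' t
  have hf' : ((D.S n).SV v).obj.ρ k ((((D.S n).univCoverOverProj (Sum.inl (D.W n)) h𝒢).fV v).hom.hom t) =
      ((D.S n).SV v).obj.ρ k' ((((D.S n).univCoverOverProj (Sum.inl (D.W n)) h𝒢).fV v).hom.hom t) :=
    e1.symm.trans (hf.trans e2)
  -- `k'⁻¹ * k` fixes the image point, hence `t`
  have hfix : ((D.S n).SV v).obj.ρ (k'⁻¹ * k)
      ((((D.S n).univCoverOverProj (Sum.inl (D.W n)) h𝒢).fV v).hom.hom t) =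
      (((D.S n).univCoverOverProj (Sum.inl (D.W n)) h𝒢).fV v).hom.hom t := by
    rw [ρ_mul_apply, hf', ← ρ_mul_apply, inv_mul_cancel, ρ_one_apply]
  have ht : ((D.cover h𝒢 n).SV v).obj.ρ (k'⁻¹ * k) t = t := D.cover_ρ_eq_self_of_proj h𝒢 n _ t hfix
  have heq : (σ.hom.fV v).hom.hom t = (σ'.hom.fV v).hom.hom t := by
    rw [← hk, ← hk']
    have := congrArg (((D.cover h𝒢 n).SV v).obj.ρ k') ht
    rwa [← ρ_mul_apply, ← mul_assoc, mul_inv_cancel, one_mul] at this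
  exact Iso.ext ((D.S n).univCoverOver_hom_ext (Sum.inl (D.W n)) h𝒢 σ.hom σ'.hom t heq)

/-- Edge twin: the stabiliser of the tree edge `[t]` injects into the fibre `(𝒢_n)_e`.
[cite: MochizukiSemiAnbd2006, Thm 3.7(iv) p.41] -/
theorem injOn_proj_apply_of_fixes_edgeMk (n : ℕ) {e : 𝒢.graph.Edge}
    (t : ((D.cover h𝒢 n).SE e).obj.V) :
    Set.InjOn (fun σ : D.Gal h𝒢 n =>
        (((D.S n).univCoverOverProj (Sum.inl (D.W n)) h𝒢).fE e).hom.hom ((σ.hom.fE e).hom.hom t))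
      {σ | (D.galTreeAct h𝒢 n σ).hom.edgeMap ((D.treeIso h𝒢 n).hom.edgeMap (Quot.mk _ ⟨e, t⟩)) =
        (D.treeIso h𝒢 n).hom.edgeMap (Quot.mk _ ⟨e, t⟩)} := by
  intro σ hσ σ' hσ' hf
  obtain ⟨k, hk⟩ := D.exists_ρ_eq_apply_of_fixes_edgeMk h𝒢 n t σ hσ
  obtain ⟨k', hk'⟩ := D.exists_ρ_eq_apply_of_fixes_edgeMk h𝒢 n t σ' hσ'
  simp only at hf
  rw [← hk, ← hk'] at hf
  have e1 := CovHom.fE_ρ ((D.S n).univCoverOverProj (Sum.inl (D.W n)) h𝒢) e k t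
  have e2 := CovHom.fE_ρ ((D.S n).univCoverOverProj (Sum.inl (D.W n)) h𝒢) e k' t
  have hf' : ((D.S n).SE e).obj.ρ k ((((D.S n).univCoverOverProj (Sum.inl (D.W n)) h𝒢).fE e).hom.hom t) =
      ((D.S n).SE e).obj.ρ k' ((((D.S n).univCoverOverProj (Sum.inl (D.W n)) h𝒢).fE e).hom.hom t) :=
    e1.symm.trans (hf.trans e2)
  have hfix : ((D.S n).SE e).obj.ρ (k'⁻¹ * k)
      ((((D.S n).univCoverOverProj (Sum.inl (D.W n)) h𝒢).fE e).hom.hom t) =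
      (((D.S n).univCoverOverProj (Sum.inl (D.W n)) h𝒢).fE e).hom.hom t := by
    rw [ρ_mul_apply, hf', ← ρ_mul_apply, inv_mul_cancel, ρ_one_apply]
  have ht : ((D.cover h𝒢 n).SE e).obj.ρ (k'⁻¹ * k) t = t := D.cover_ρE_eq_self_of_proj h𝒢 n _ t hfix
  have heq : (σ.hom.fE e).hom.hom t = (σ'.hom.fE e).hom.hom t := by
    rw [← hk, ← hk']
    have := congrArg (((D.cover h𝒢 n).SE e).obj.ρ k') ht
    rwa [← ρ_mul_apply, ← mul_assoc, mul_inv_cancel, one_mul] at this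
  exact Iso.ext ((D.S n).univCoverOver_hom_ext_edge (Sum.inl (D.W n)) h𝒢 σ.hom σ'.hom t heq)

/-- **Vertex stabilisers in `Aut(𝒢_{∞,n})` are finite of order at most `#(𝒢_n)_v`.**
[cite: MochizukiSemiAnbd2006, Thm 3.7(iv) p.41] -/
theorem finite_and_ncard_le_of_vertexMk (n : ℕ) {v : 𝒢.graph.Vertex} [Finite ((D.S n).SV v).obj.V]
    (t : ((D.cover h𝒢 n).SV v).obj.V) :
    ({σ : D.Gal h𝒢 n | (D.galTreeAct h𝒢 n σ).hom.vertexMap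
        ((D.treeIso h𝒢 n).hom.vertexMap (Quot.mk _ ⟨v, t⟩)) =
        (D.treeIso h𝒢 n).hom.vertexMap (Quot.mk _ ⟨v, t⟩)} : Set (D.Gal h𝒢 n)).Finite ∧
    ({σ : D.Gal h𝒢 n | (D.galTreeAct h𝒢 n σ).hom.vertexMap
        ((D.treeIso h𝒢 n).hom.vertexMap (Quot.mk _ ⟨v, t⟩)) =
        (D.treeIso h𝒢 n).hom.vertexMap (Quot.mk _ ⟨v, t⟩)} : Set (D.Gal h𝒢 n)).ncard ≤
      Nat.card ((D.S n).SV v).obj.V := by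
  have hinj := D.injOn_proj_apply_of_fixes_vertexMk h𝒢 n t
  have hfin := Set.Finite.of_injOn (f := fun σ : D.Gal h𝒢 n =>
      (((D.S n).univCoverOverProj (Sum.inl (D.W n)) h𝒢).fV v).hom.hom ((σ.hom.fV v).hom.hom t))
    (fun _ _ => Set.mem_univ _) hinj Set.finite_univ
  refine ⟨hfin, ?_⟩
  calc _ ≤ (Set.univ : Set ((D.S n).SV v).obj.V).ncard :=
        Set.ncard_le_ncard_of_injOn _ (fun _ _ => Set.mem_univ _) hinj Set.finite_univ
    _ = Nat.card ((D.S n).SV v).obj.V := Set.ncard_univ _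

/-- **Edge stabilisers in `Aut(𝒢_{∞,n})` are finite of order at most `#(𝒢_n)_e`.**
[cite: MochizukiSemiAnbd2006, Thm 3.7(iv) p.41] -/
theorem finite_and_ncard_le_of_edgeMk (n : ℕ) {e : 𝒢.graph.Edge} [Finite ((D.S n).SE e).obj.V]
    (t : ((D.cover h𝒢 n).SE e).obj.V) :
    ({σ : D.Gal h𝒢 n | (D.galTreeAct h𝒢 n σ).hom.edgeMap
        ((D.treeIso h𝒢 n).hom.edgeMap (Quot.mk _ ⟨e, t⟩)) =
        (D.treeIso h𝒢 n).hom.edgeMap (Quot.mk _ ⟨e, t⟩)} : Set (D.Gal h𝒢 n)).Finite ∧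
    ({σ : D.Gal h𝒢 n | (D.galTreeAct h𝒢 n σ).hom.edgeMap
        ((D.treeIso h𝒢 n).hom.edgeMap (Quot.mk _ ⟨e, t⟩)) =
        (D.treeIso h𝒢 n).hom.edgeMap (Quot.mk _ ⟨e, t⟩)} : Set (D.Gal h𝒢 n)).ncard ≤
      Nat.card ((D.S n).SE e).obj.V := by
  have hinj := D.injOn_proj_apply_of_fixes_edgeMk h𝒢 n t
  have hfin := Set.Finite.of_injOn (f := fun σ : D.Gal h𝒢 n =>
      (((D.S n).univCoverOverProj (Sum.inl (D.W n)) h𝒢).fE e).hom.hom ((σ.hom.fE e).hom.hom t))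
    (fun _ _ => Set.mem_univ _) hinj Set.finite_univ
  refine ⟨hfin, ?_⟩
  calc _ ≤ (Set.univ : Set ((D.S n).SE e).obj.V).ncard :=
        Set.ncard_le_ncard_of_injOn _ (fun _ _ => Set.mem_univ _) hinj Set.finite_univ
    _ = Nat.card ((D.S n).SE e).obj.V := Set.ncard_univ _

/-! ### Finite subgroups of `Gal(𝒢_{∞,n}/𝒢)` have bounded order -/

/-- **Finite subgroups of `Gal(𝒢_{∞,n}/𝒢)` have order at most `d`** whenever every fibre of the finite
level `𝒢_n` has at most `d` points: a finite subgroup fixes a vertex or an edge of the tree `𝔾̃_n`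
(Lem. 1.8 (ii)(a)) and the stabilisers inject into the fibres. [cite: MochizukiSemiAnbd2006, Thm 3.7(iv) p.41] -/
theorem natCard_le_of_finite_subgroup (n : ℕ) (hfin : (D.S n).IsFinite) (d : ℕ)
    (hdV : ∀ v : 𝒢.graph.Vertex, Nat.card ((D.S n).SV v).obj.V ≤ d)
    (hdE : ∀ e : 𝒢.graph.Edge, Nat.card ((D.S n).SE e).obj.V ≤ d)
    (H : Subgroup (D.Gal h𝒢 n)) (hH : (H : Set (D.Gal h𝒢 n)).Finite) : Nat.card H ≤ d := by
  haveI := hfin.finite_V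
  haveI := hfin.finite_E
  refine SemiGraph.ncard_le_of_finite_of_treeAction (D.tree n) (D.isTree_tree n) (D.galTreeAct h𝒢 n)
    (fun y => ?_) (fun y => ?_) H hH
  · obtain ⟨t, ht⟩ := D.exists_point_over (h𝒢 := h𝒢) n y rfl
    obtain ⟨h1, h2⟩ := D.finite_and_ncard_le_of_vertexMk h𝒢 n t
    rw [ht] at h1 h2
    exact ⟨h1, h2.trans (hdV _)⟩
  · obtain ⟨t, ht⟩ := D.exists_edgePoint_over (h𝒢 := h𝒢) n y rfl
    obtain ⟨h1, h2⟩ := D.finite_and_ncard_le_of_edgeMk h𝒢 n t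
    rw [ht] at h1 h2
    exact ⟨h1, h2.trans (hdE _)⟩

/-- **The binder `hbd` DISCHARGED** for Galois level data with finite levels over a CONNECTED `𝒢`:
at every level the finite subgroups of `Gal(𝒢_{∞,n}/𝒢)` have bounded order (bound: the common fibre
cardinality of `𝒢_n`, `CovObj.nodeCard_eq_of_reachable`). [cite: MochizukiSemiAnbd2006, Thm 3.7(iv) p.41] -/
theorem hbd_of_isFinite (hc : 𝒢.graph.IsConnected) (hv : 𝒢.HasVertex)
    (hfin : ∀ n, (D.S n).IsFinite) (n : ℕ) :
    ∃ B : ℕ, ∀ H : Subgroup (D.Gal h𝒢 n), (H : Set (D.Gal h𝒢 n)).Finite → Nat.card H ≤ B := by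
  obtain ⟨v₀⟩ := hv
  refine ⟨(D.S n).nodeCard (Sum.inl v₀), fun H hH =>
    D.natCard_le_of_finite_subgroup h𝒢 n (hfin n) _ (fun v => ?_) (fun e => ?_) H hH⟩
  · exact ((D.S n).nodeCard_eq_of_reachable (hc.connected.preconnected (Sum.inl v) (Sum.inl v₀))).le
  · exact ((D.S n).nodeCard_eq_of_reachable
      (hc.connected.preconnected (Sum.inr (Sum.inl e)) (Sum.inl v₀))).le

/-- **Every compact subgroup of `π₁^temp(𝒢) = lim_n Gal(𝒢_{∞,n}/𝒢)` lies in a maximal compact subgroup**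
(connected `𝒢` with a vertex, finite levels): abc-iut-w6-d120's Zorn lemma with `hbd` discharged.
[cite: MochizukiSemiAnbd2006, Thm 3.7(iv) p.41] -/
theorem exists_isMaximalCompactSubgroup_ge_of_isFinite (hc : 𝒢.graph.IsConnected) (hv : 𝒢.HasVertex)
    (hfin : ∀ n, (D.S n).IsFinite) (C : Subgroup (D.temperedPi h𝒢))
    (hC : IsCompact (C : Set (D.temperedPi h𝒢))) :
    ∃ K : Subgroup (D.temperedPi h𝒢), IsMaximalCompactSubgroup K ∧ C ≤ K :=
  D.exists_isMaximalCompactSubgroup_ge h𝒢 (D.hbd_of_isFinite h𝒢 hc hv hfin) C hC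

/-- In particular maximal compact subgroups of `π₁^temp(𝒢)` exist.
[cite: MochizukiSemiAnbd2006, Thm 3.7(iv) p.41] -/
theorem exists_isMaximalCompactSubgroup_of_isFinite (hc : 𝒢.graph.IsConnected) (hv : 𝒢.HasVertex)
    (hfin : ∀ n, (D.S n).IsFinite) :
    ∃ K : Subgroup (D.temperedPi h𝒢), IsMaximalCompactSubgroup K :=
  D.exists_isMaximalCompactSubgroup h𝒢 (D.hbd_of_isFinite h𝒢 hc hv hfin)

end GaloisLevelData

/-! ### The canonical tower of Proposition 3.6 -/

/-- **`hbd` for the canonical tower** `galoisLevelData h36` (the exact binder of the (iv)-refutation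
files): at every level the finite subgroups of `Gal(𝒢_{∞,n}/𝒢)` have bounded order.
[cite: MochizukiSemiAnbd2006, Thm 3.7(iv) p.41] -/
theorem hbd_galoisLevelData (𝒢 : ProfiniteSemiGraph.{u}) (h36 : 𝒢.Prop36Hypotheses) (n : ℕ) :
    ∃ B : ℕ, ∀ H : Subgroup ((𝒢.galoisLevelData h36).Gal h36.isCountable n),
      (H : Set ((𝒢.galoisLevelData h36).Gal h36.isCountable n)).Finite → Nat.card H ≤ B :=
  (𝒢.galoisLevelData h36).hbd_of_isFinite h36.isCountable h36.isConnected h36.hasVertex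
    (𝒢.galoisLevelData_isFinite h36) n

/-- **Every compact subgroup of `π₁^temp(𝒢)` lies in a maximal compact subgroup** — for the tempered
fundamental group of Prop. 3.6 (i) of ANY `𝒢` satisfying the hypotheses of Prop. 3.6, binder-free.
[cite: MochizukiSemiAnbd2006, Thm 3.7(iv) p.41] -/
theorem exists_isMaximalCompactSubgroup_ge_temperedPi (𝒢 : ProfiniteSemiGraph.{u})
    (h36 : 𝒢.Prop36Hypotheses) (C : Subgroup (𝒢.temperedPi h36))
    (hC : IsCompact (C : Set (𝒢.temperedPi h36))) :
    ∃ K : Subgroup (𝒢.temperedPi h36), IsMaximalCompactSubgroup K ∧ C ≤ K :=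
  (𝒢.galoisLevelData h36).exists_isMaximalCompactSubgroup_ge_of_isFinite h36.isCountable
    h36.isConnected h36.hasVertex (𝒢.galoisLevelData_isFinite h36) C hC

/-- The same at the constructed chart `𝒢.temperedPiChart h36` (whose group IS `𝒢.temperedPi h36`).
[cite: MochizukiSemiAnbd2006, Thm 3.7(iv) p.41] -/
theorem exists_isMaximalCompactSubgroup_ge_temperedPiChart (𝒢 : ProfiniteSemiGraph.{u})
    (h36 : 𝒢.Prop36Hypotheses) (C : Subgroup (𝒢.temperedPiChart h36).G)
    (hC : IsCompact (C : Set (𝒢.temperedPiChart h36).G)) :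
    ∃ K : Subgroup (𝒢.temperedPiChart h36).G, IsMaximalCompactSubgroup K ∧ C ≤ K :=
  𝒢.exists_isMaximalCompactSubgroup_ge_temperedPi h36 C hC

end ProfiniteSemiGraph

end Literature.AnabelianGeometry.SemiGraphs
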